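import Summits.Schanuel.Schanuel.Theorems.ZilberEacBranchEqualOrderGrowth
import Summits.Schanuel.Schanuel.Theorems.ZilberEacCurveGraphFibreCase
import Summits.Schanuel.Schanuel.Theorems.ZilberEacEllipticBaseExample
import Mathlib.RingTheory.Polynomial.Eisenstein.Basic
import HarnessLib

/-!
# Arbitrary base branches, XVIII: the SLOW regime — CONSTANT fibres over the genus-one cubic
# `x₁³ = x₀² + 1` are dense (second coordinate growing SLOWER, `M = 2 < k = 3`)

HONEST FRAMING.  Cell `pub-schanuel` (Zilber's Exponential-Algebraic Closedness, case ladder;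
host summit Schanuel), seat 2, gen 28.  Over a polynomial GRAPH a constant-fibre cylinder can fail to
be dense (`{x₁ = x₀²/(2πi), y₀ = 1}`, gen 22).  Over the cubic `C : x₁³ = x₀² + 1` (a plane model
of an elliptic curve) the branch at infinity is `x₀ = s^{-3}`, `x₁ = (1 + s⁶)^{1/3}s^{-2}`: the
second coordinate grows SLOWER than the label coordinate (`M = 2 < k = 3`) — a regime outside files
I–XIII (`M ≥ k + 1`) and XV's equal-order corollary.  File XV's general growth theorem
`unprojectedDense_branch_growth_of_re_ne_zero` applies: for every cube root `z` of `2πi`,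
`Re(z²) ≠ 0` (if `z² ∈ iℝ` then `z³ = 2πi` forces `z ∈ ℝ`, so `z² ∈ ℝ ∩ iℝ = 0`).  Hence
**`unprojectedDensityQuestion_cubicBase_constFibre`**: for every `θ ≠ 0` the constant-fibre
cylinder `{x₁³ − x₀² − 1 = 0, y₀ = θ} ⊆ ℂ² × ℂ²` is in Mantova–Masser's case (dim-π-S-1-free) AND has
Zariski-dense exponential points (they are the points `(x₀, x₁, θ, e^{x₁})` with
`(x₀, x₁) ∈ C`, `x₀ ∈ log θ + 2πiℤ`).  Irreducibility of `t³ − (s² + 1)`: Eisenstein at `(s − i)`.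
A decided instance of an OPEN question (Mantova–Masser, PLMS 2024 §1 p. 5); EC(3,2) OPEN; NOT
Schanuel's conjecture (neither used nor implied); EAC ⇏ SC.
-/

noncomputable section

open Filter Topology Set Complex MvPolynomial
open Literature.NumberTheory.Transcendental Literature.ModelTheory.Zilber
open Literature.ModelTheory.ExponentialFields

set_option linter.dupNamespace false

namespace Summit.Schanuel.Schanuel.Theorems

/-! ## Part A. The cubic is irreducible (Eisenstein at `s − i`) -/

/-- `(X − i)² ∤ −(X² + 1)` in `ℂ[X]` (the root `i` is simple). [folklore] -/
theorem X_sub_I_sq_not_dvd_neg_X_sq_add_one :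
    ¬ (Polynomial.X - Polynomial.C I) ^ 2 ∣ (-(Polynomial.X ^ 2 + 1) : Polynomial ℂ) := by
  rintro ⟨q, hq⟩
  have hd := congrArg (fun p : Polynomial ℂ => (Polynomial.derivative p).eval I) hq
  simp only [Polynomial.derivative_neg, Polynomial.derivative_add, Polynomial.derivative_one,
    add_zero, Polynomial.derivative_mul, Polynomial.derivative_pow, Polynomial.derivative_sub,
    Polynomial.derivative_X, Polynomial.derivative_C, sub_zero, Polynomial.eval_neg,
    Polynomial.eval_mul, Polynomial.eval_pow, Polynomial.eval_sub, Polynomial.eval_X,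
    Polynomial.eval_C, Polynomial.eval_add, sub_self, mul_one] at hd
  norm_num at hd

/-- The cubic relation `t³ − (s² + 1)` is irreducible in `ℂ[s][t]` (Eisenstein at `(s − i)`).
[folklore] -/
theorem irreducible_cubicBase_row :
    Irreducible (Polynomial.X ^ 3 + Polynomial.C (-(Polynomial.X ^ 2 + 1) : Polynomial ℂ)) := by
  set f : Polynomial (Polynomial ℂ) := Polynomial.X ^ 3 + Polynomial.C (-(Polynomial.X ^ 2 + 1)) with hf
  set P : Ideal (Polynomial ℂ) := Ideal.span {Polynomial.X - Polynomial.C I} with hP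
  have hPprime : P.IsPrime := by
    rw [hP, Ideal.span_singleton_prime (Polynomial.X_sub_C_ne_zero I)]
    exact Polynomial.prime_X_sub_C I
  have hmonic : f.Monic := by
    rw [hf]
    exact Polynomial.monic_X_pow_add_C _ (by norm_num)
  have hdeg : f.natDegree = 3 := by
    rw [hf, Polynomial.natDegree_X_pow_add_C]
  have hdvd : (Polynomial.X - Polynomial.C I) ∣ (-(Polynomial.X ^ 2 + 1) : Polynomial ℂ) := by
    rw [Polynomial.dvd_iff_isRoot]
    simp [Polynomial.IsRoot, Complex.I_sq]
  have heis : f.IsEisensteinAt P := by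
    refine ⟨?_, fun {j} hj => ?_, ?_⟩
    · rw [hmonic.leadingCoeff]
      intro h1
      have : P = ⊤ := (Ideal.eq_top_iff_one P).2 h1
      exact hPprime.ne_top this
    · rw [hdeg] at hj
      rw [hf, Polynomial.coeff_add, Polynomial.coeff_X_pow, if_neg (by omega), zero_add,
        Polynomial.coeff_C]
      split_ifs with h0
      · exact Ideal.mem_span_singleton.2 hdvd
      · exact Ideal.zero_mem _
    · rw [hf, Polynomial.coeff_add, Polynomial.coeff_X_pow, if_neg (by omega), zero_add,
        Polynomial.coeff_C_zero, hP, Ideal.span_singleton_pow, Ideal.mem_span_singleton]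
      exact X_sub_I_sq_not_dvd_neg_X_sq_add_one
  exact heis.irreducible hPprime hmonic.isPrimitive (by rw [hdeg]; norm_num)

/-- Evaluation of `x₁³ − x₀² − 1`. -/
theorem eval_cubicBaseMv (x : Fin 2 → ℂ) :
    MvPolynomial.eval x (X 1 ^ 3 - X 0 ^ 2 - 1 : MvPolynomial (Fin 2) ℂ) = x 1 ^ 3 - x 0 ^ 2 - 1 := by
  simp

/-- The cubic polynomial and its rows. -/
theorem eval_cubicBaseMv_rows (x y : ℂ) :
    MvPolynomial.eval ![x, y] (X 1 ^ 3 - X 0 ^ 2 - 1 : MvPolynomial (Fin 2) ℂ) =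
      ((Polynomial.X ^ 3 + Polynomial.C (-(Polynomial.X ^ 2 + 1) : Polynomial ℂ)).map
        (Polynomial.evalRingHom x)).eval y := by
  rw [eval_cubicBaseMv]
  simp
  ring

/-- The cubic `x₁³ − x₀² − 1` is irreducible in `ℂ[x₀, x₁]`. [folklore] -/
theorem irreducible_cubicBaseMv : Irreducible (X 1 ^ 3 - X 0 ^ 2 - 1 : MvPolynomial (Fin 2) ℂ) :=
  (irreducible_rows_iff eval_cubicBaseMv_rows).2 irreducible_cubicBase_row

/-! ## Part B. The direction condition and density -/

/-- **For every cube root `z` of `2πi`, `Re(z²) ≠ 0`.** [folklore] -/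
theorem re_sq_ne_zero_of_cube_eq_two_pi_I {z : ℂ} (hz : z ^ 3 = 2 * Real.pi * I) : (z ^ 2).re ≠ 0 := by
  intro hre
  -- `z² = i·t` with `t = Im(z²)` real
  have hz2 : z ^ 2 = ((z ^ 2).im : ℂ) * I := by
    apply Complex.ext <;> simp [hre]
  -- `z³ = z·z² = z·t·i = 2πi`, so `z·t = 2π`: `z` is real, hence `z²` is real, so `t = 0`: absurd
  have h3 : z * (((z ^ 2).im : ℂ) * I) = 2 * Real.pi * I := by
    rw [← hz2, ← hz]; ring
  have hzt : z * ((z ^ 2).im : ℂ) = 2 * Real.pi := by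
    have h3' : z * ((z ^ 2).im : ℂ) * I = 2 * Real.pi * I := by
      rw [mul_assoc]; exact h3
    exact mul_right_cancel₀ Complex.I_ne_zero h3'
  have ht0 : (z ^ 2).im ≠ 0 := by
    intro h0
    rw [h0, Complex.ofReal_zero, mul_zero] at hzt
    have : (2 * Real.pi : ℂ) ≠ 0 := by exact_mod_cast (by positivity : (2 * Real.pi : ℝ) ≠ 0)
    exact this hzt.symm
  have hzreal : z = (((2 * Real.pi) / (z ^ 2).im : ℝ) : ℂ) := by
    have htC : ((z ^ 2).im : ℂ) ≠ 0 := by exact_mod_cast ht0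
    rw [Complex.ofReal_div]
    push_cast
    field_simp
    exact hzt
  have hz2im : (z ^ 2).im = 0 := by
    rw [hzreal, ← Complex.ofReal_pow, Complex.ofReal_im]
  exact ht0 hz2im

/-- The analytic data: `q(v) = (1 + v)^{1/3}` (principal), `q(0) = 1`, `q(v)³ = 1 + v` near `0`.
[folklore] -/
theorem cubicBase_branch_facts :
    ∃ q : ℂ → ℂ, AnalyticAt ℂ q 0 ∧ q 0 = 1 ∧ ∀ᶠ v in 𝓝 (0 : ℂ), q v ^ 3 = 1 + v := by
  set q : ℂ → ℂ := fun v => Complex.exp ((1 / 3 : ℂ) * Complex.log (1 + v)) with hq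
  have h1v : AnalyticAt ℂ (fun v : ℂ => 1 + v) 0 := analyticAt_const.add analyticAt_id
  have hqan : AnalyticAt ℂ q 0 :=
    (analyticAt_const.mul (h1v.clog (by simp [Complex.one_mem_slitPlane]))).cexp
  have hq0 : q 0 = 1 := by simp [hq]
  have hsmall : ∀ᶠ v in 𝓝 (0 : ℂ), ‖v‖ < 1 := by
    have := Metric.ball_mem_nhds (0 : ℂ) one_pos
    filter_upwards [this] with v hv
    rwa [Metric.mem_ball, dist_zero_right] at hv
  refine ⟨q, hqan, hq0, ?_⟩
  filter_upwards [hsmall] with v hv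
  have hne0 : 1 + v ≠ 0 := Complex.slitPlane_ne_zero (Complex.mem_slitPlane_of_norm_lt_one hv)
  rw [hq]
  simp only
  rw [← Complex.exp_nat_mul, ← mul_assoc, show ((3 : ℕ) : ℂ) * (1 / 3 : ℂ) = 1 by norm_num, one_mul]
  exact Complex.exp_log hne0

/-- **The constant-fibre cylinder `{x₁³ − x₀² − 1 = 0, y₀ = θ}` (`θ ≠ 0`) has Zariski-dense
exponential points.** [cite: MantovaMasser2023, §1 Further remarks, p. 5 (the question, open in
general)] (new) -/
theorem unprojectedDense_cubicBase_constFibre {θ : ℂ} (hθ : θ ≠ 0) :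
    UnprojectedDense {w : Fin 2 ⊕ Fin 2 → ℂ |
      MvPolynomial.eval ![w (Sum.inl 0), w (Sum.inl 1)] (X 1 ^ 3 - X 0 ^ 2 - 1 : MvPolynomial (Fin 2) ℂ) = 0 ∧
      w (Sum.inr 0) = MvPolynomial.eval ![w (Sum.inl 0), w (Sum.inl 1)]
        (MvPolynomial.C θ : MvPolynomial (Fin 2) ℂ)} := by
  have hS := isIrreducibleClosed_curveGraphFibre (MvPolynomial.C θ : MvPolynomial (Fin 2) ℂ)
    irreducible_cubicBaseMv
  have hdim := zariskiDim_curveGraphFibre (MvPolynomial.C θ : MvPolynomial (Fin 2) ℂ)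
    irreducible_cubicBaseMv
  obtain ⟨q, hqan, hq0, hq3⟩ := cubicBase_branch_facts
  -- `x₀ = s^{-3}`, `x₁ = q(s⁶) s^{-2}`, `y₀ = θ`
  set Φ : ℂ → ℂ := fun s => q (s ^ 6) with hΦ
  have hs6 : AnalyticAt ℂ (fun s : ℂ => s ^ 6) 0 := analyticAt_id.pow 6
  have hΦan : AnalyticAt ℂ Φ 0 := hqan.comp_of_eq hs6 (by simp)
  have hΦ0 : Φ 0 = 1 := by simp [hΦ, hq0]
  have hψan : AnalyticAt ℂ (fun _ : ℂ => θ) 0 := analyticAt_const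
  have hq3' : ∀ᶠ s in 𝓝 (0 : ℂ), q (s ^ 6) ^ 3 = 1 + s ^ 6 := by
    have h := hs6.continuousAt.tendsto
    simp only [ne_eq, OfNat.ofNat_ne_zero, not_false_eq_true, zero_pow] at h
    exact h.eventually hq3
  have hdir : ∀ z : ℂ, z ^ 3 = 2 * Real.pi * I → (Φ 0 * z ^ 2).re ≠ 0 := by
    intro z hz
    rw [hΦ0, one_mul]
    exact re_sq_ne_zero_of_cube_eq_two_pi_I hz
  have hgerm : ∀ᶠ s in 𝓝[≠] (0 : ℂ),
      (Sum.elim ![(s ^ 3)⁻¹, Φ s * (s ^ 2)⁻¹] ![(fun _ : ℂ => θ) s, Complex.exp (Φ s * (s ^ 2)⁻¹)] :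
        Fin 2 ⊕ Fin 2 → ℂ) ∈ {w : Fin 2 ⊕ Fin 2 → ℂ |
      MvPolynomial.eval ![w (Sum.inl 0), w (Sum.inl 1)] (X 1 ^ 3 - X 0 ^ 2 - 1 : MvPolynomial (Fin 2) ℂ) = 0 ∧
      w (Sum.inr 0) = MvPolynomial.eval ![w (Sum.inl 0), w (Sum.inl 1)]
        (MvPolynomial.C θ : MvPolynomial (Fin 2) ℂ)} := by
    filter_upwards [self_mem_nhdsWithin, nhdsWithin_le_nhds hq3'] with s (hs : s ≠ 0) hqs
    refine ⟨?_, ?_⟩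
    · simp only [Sum.elim_inl, Matrix.cons_val_zero, Matrix.cons_val_one]
      rw [eval_cubicBaseMv]
      simp only [Matrix.cons_val_zero, Matrix.cons_val_one, hΦ]
      rw [mul_pow, hqs]
      field_simp
      ring
    · simp only [Sum.elim_inr, Matrix.cons_val_zero, MvPolynomial.eval_C]
  exact unprojectedDense_branch_growth_of_re_ne_zero hS (le_of_eq hdim) (by norm_num : 1 ≤ 3)
    (by norm_num : 1 ≤ 2) hψan hθ rfl hΦan hdir hgerm

/-! ## Part C. The case certificate, and case ∧ dense -/

/-- **The constant-fibre cylinder over the cubic is in Mantova–Masser's case** (`θ ≠ 0`). (new) -/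
theorem mmCase_cubicBase_constFibre {θ : ℂ} (hθ : θ ≠ 0) :
    MMCaseDimPiOneFree {w : Fin 2 ⊕ Fin 2 → ℂ |
      MvPolynomial.eval ![w (Sum.inl 0), w (Sum.inl 1)] (X 1 ^ 3 - X 0 ^ 2 - 1 : MvPolynomial (Fin 2) ℂ) = 0 ∧
      w (Sum.inr 0) = MvPolynomial.eval ![w (Sum.inl 0), w (Sum.inl 1)]
        (MvPolynomial.C θ : MvPolynomial (Fin 2) ℂ)} := by
  refine mmCase_curveGraphFibre irreducible_cubicBaseMv ?_ ?_
  · exact ⟨![0, 1], by rw [eval_cubicBaseMv]; simp, by rw [MvPolynomial.eval_C]; exact hθ⟩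
  · -- `(0,1)`, `(0,ω)` (`ω = e^{2πi/3}`), `(i, 0)` are on the cubic and not collinear
    intro m hm c
    have hω := Complex.isPrimitiveRoot_exp 3 (by norm_num)
    set ω : ℂ := Complex.exp (2 * Real.pi * I / (3 : ℕ)) with hωdef
    have hω3 : ω ^ 3 = 1 := hω.pow_eq_one
    have hω1 : ω ≠ 1 := hω.ne_one (by norm_num)
    by_cases h1 : (m 0 : ℂ) * 0 + (m 1 : ℂ) * 1 ≠ c
    · exact ⟨![0, 1], by rw [eval_cubicBaseMv]; simp, by simpa using h1⟩
    by_cases h2 : (m 0 : ℂ) * 0 + (m 1 : ℂ) * ω ≠ c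
    · exact ⟨![0, ω], by rw [eval_cubicBaseMv]; simp [hω3], by simpa using h2⟩
    push Not at h1 h2
    refine ⟨![I, 0], by rw [eval_cubicBaseMv]; simp [Complex.I_sq], ?_⟩
    simp only [Matrix.cons_val_zero, Matrix.cons_val_one, mul_zero, add_zero]
    intro h3
    have hm1 : (m 1 : ℂ) = 0 := by
      have h : (m 1 : ℂ) * (1 - ω) = 0 := by linear_combination h1 - h2
      rcases mul_eq_zero.1 h with h | h
      · exact h
      · exact absurd (by linear_combination -h) hω1
    have hc : c = 0 := by rw [← h1, hm1]; simp
    have hm0 : (m 0 : ℂ) = 0 := by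
      rw [hc] at h3
      rcases mul_eq_zero.1 h3 with h | h
      · exact h
      · exact absurd h Complex.I_ne_zero
    apply hm
    funext i
    fin_cases i
    · exact_mod_cast hm0
    · exact_mod_cast hm1

/-- **Mantova–Masser's question for constant fibres over the cubic: case ∧ dense** (`θ ≠ 0`).
[cite: MantovaMasser2023, §1 Further remarks, p. 5 (the question, open in general)] (new) -/
theorem unprojectedDensityQuestion_cubicBase_constFibre {θ : ℂ} (hθ : θ ≠ 0) :
    MMCaseDimPiOneFree {w : Fin 2 ⊕ Fin 2 → ℂ |
        MvPolynomial.eval ![w (Sum.inl 0), w (Sum.inl 1)] (X 1 ^ 3 - X 0 ^ 2 - 1 : MvPolynomial (Fin 2) ℂ) = 0 ∧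
        w (Sum.inr 0) = MvPolynomial.eval ![w (Sum.inl 0), w (Sum.inl 1)]
          (MvPolynomial.C θ : MvPolynomial (Fin 2) ℂ)} ∧
      UnprojectedDense {w : Fin 2 ⊕ Fin 2 → ℂ |
        MvPolynomial.eval ![w (Sum.inl 0), w (Sum.inl 1)] (X 1 ^ 3 - X 0 ^ 2 - 1 : MvPolynomial (Fin 2) ℂ) = 0 ∧
        w (Sum.inr 0) = MvPolynomial.eval ![w (Sum.inl 0), w (Sum.inl 1)]
          (MvPolynomial.C θ : MvPolynomial (Fin 2) ℂ)} :=
  ⟨mmCase_cubicBase_constFibre hθ, unprojectedDense_cubicBase_constFibre hθ⟩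

/-- **Plain coordinates**: `{x₁³ − x₀² − 1 = 0, y₀ = θ}` (`θ ≠ 0`) is in the case AND dense.
[cite: MantovaMasser2023, §1 Further remarks, p. 5 (the question, open in general)] (new) -/
theorem unprojectedDensityQuestion_cubicBase_constFibre' {θ : ℂ} (hθ : θ ≠ 0) :
    MMCaseDimPiOneFree {w : Fin 2 ⊕ Fin 2 → ℂ |
        w (Sum.inl 1) ^ 3 - w (Sum.inl 0) ^ 2 - 1 = 0 ∧ w (Sum.inr 0) = θ} ∧
      UnprojectedDense {w : Fin 2 ⊕ Fin 2 → ℂ |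
        w (Sum.inl 1) ^ 3 - w (Sum.inl 0) ^ 2 - 1 = 0 ∧ w (Sum.inr 0) = θ} := by
  have e : {w : Fin 2 ⊕ Fin 2 → ℂ |
        MvPolynomial.eval ![w (Sum.inl 0), w (Sum.inl 1)] (X 1 ^ 3 - X 0 ^ 2 - 1 : MvPolynomial (Fin 2) ℂ) = 0 ∧
        w (Sum.inr 0) = MvPolynomial.eval ![w (Sum.inl 0), w (Sum.inl 1)]
          (MvPolynomial.C θ : MvPolynomial (Fin 2) ℂ)} =
      {w : Fin 2 ⊕ Fin 2 → ℂ | w (Sum.inl 1) ^ 3 - w (Sum.inl 0) ^ 2 - 1 = 0 ∧ w (Sum.inr 0) = θ} := by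
    ext w
    simp only [Set.mem_setOf_eq, eval_cubicBaseMv, MvPolynomial.eval_C, Matrix.cons_val_zero,
      Matrix.cons_val_one]
  have h := unprojectedDensityQuestion_cubicBase_constFibre hθ
  rw [e] at h
  exact h

end Summit.Schanuel.Schanuel.Theorems
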